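import Mathlib
import HarnessLib
import Summits.ValiantsHypothesis.ValiantsHypothesis.Theorems.LacunarySymmetroidMatrixDescartesOsculationLawPeelEndMultiplicity

/-!
# ValiantsHypothesis / LacunarySymmetroid — crux `MatrixDescartes` (stmt-ValiantsHypothesis-18050, V1),
# line `Cruxes/MatrixDescartes/Lines/osculation_law.lean` («osculation-law»), stub `stub_peel` (ALL ranks):
# LEFT ENDS OF A BRANCH (rank-free; mirror images of `…PeelExtend` / `…PeelNoOscillation` at the left endpoint `α`, for
# piece (α) of NOTE-p7g12-peel-general-r-sizing.md)

The right-end lemmas `exists_extension_of_tendsto` and `not_oscillating_end` have left-end twins (as `t → α⁺`, `α > 0`):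
a continuous solution on `(α, ω)` with a limit `b* > 0` at `α⁺` extends to `(α − δ, ω)`, and it cannot oscillate between
two heights at `α⁺` when the osculation set is finite.  (A reflection `t ↦ −t` does not apply directly because
hyperbolicity and the quadrant live on `t > 0`, so the proofs are repeated with `𝓝[>] α`.)

* `eval_eq_zero_of_tendsto_left`, **`exists_extension_of_tendsto_left`**, `eval_eq_zero_of_frequently_right`,
  **`not_oscillating_left_end`**.

Honest framing: rank-free LEMMAS toward the OPEN stub `stub_peel` (all `r`); nothing of the summit is proved; `VP ≠ VNP` is
NOT proved.  No definitions, no named facts.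
-/

-- `Summit.ValiantsHypothesis.ValiantsHypothesis.…` is the tree's mandated single-conjunct layout (Sub = Summit).
set_option linter.dupNamespace false

noncomputable section

namespace Summit.ValiantsHypothesis.ValiantsHypothesis.Theorems.LacunarySymmetroidMatrixDescartes

open Polynomial Set Filter
open MvPolynomial (pderiv)
open scoped BigOperators Topology

namespace OsculationPeel

/-- Closedness at the left end: `Φ(t, β t) = 0` on `(α, ω)` and `β → b*` as `t → α⁺` give `Φ(α, b*) = 0`. [folklore] -/
theorem eval_eq_zero_of_tendsto_left (Φ : MvPolynomial (Fin 2) ℝ) {α ω bstar : ℝ} {β : ℝ → ℝ} (hαω : α < ω)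
    (hsol : ∀ t ∈ Ioo α ω, MvPolynomial.eval ![t, β t] Φ = 0) (hlim : Tendsto β (𝓝[>] α) (𝓝 bstar)) :
    MvPolynomial.eval ![α, bstar] Φ = 0 := by
  have hid : Tendsto (fun u : ℝ => u) (𝓝[>] α) (𝓝 α) := tendsto_id.mono_left nhdsWithin_le_nhds
  have hcont := ((continuous_eval₂ Φ).tendsto (α, bstar)).comp (hid.prodMk_nhds hlim)
  have hev : ∀ᶠ u in 𝓝[>] α, MvPolynomial.eval ![u, β u] Φ = 0 :=
    mem_of_superset (Ioo_mem_nhdsGT hαω) fun u hu => hsol u hu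
  have h0 : Tendsto (fun u => MvPolynomial.eval ![u, β u] Φ) (𝓝[>] α) (𝓝 0) :=
    tendsto_const_nhds.congr' (hev.mono fun u hu => hu.symm)
  exact tendsto_nhds_unique hcont h0

/-- **A branch with a finite positive limit at its LEFT end extends to the left.** [folklore] -/
theorem exists_extension_of_tendsto_left (Φ : MvPolynomial (Fin 2) ℝ) (P : ℝ → ℝ[X])
    (hP : ∀ t b, (P t).eval b = MvPolynomial.eval ![t, b] Φ) (hsplit : ∀ t, 0 < t → (P t).Splits)
    (hfin : {p : Fin 2 → ℝ | 0 < p 0 ∧ 0 < p 1 ∧ MvPolynomial.eval p Φ = 0 ∧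
      MvPolynomial.eval p
        (MvPolynomial.X 0 * MvPolynomial.pderiv 0 (MvPolynomial.X 0 * MvPolynomial.pderiv 0 Φ)
            * (MvPolynomial.X 1 * MvPolynomial.pderiv 1 Φ) ^ 2
          - 2 * (MvPolynomial.X 0 * MvPolynomial.pderiv 0 (MvPolynomial.X 1 * MvPolynomial.pderiv 1 Φ))
            * (MvPolynomial.X 0 * MvPolynomial.pderiv 0 Φ) * (MvPolynomial.X 1 * MvPolynomial.pderiv 1 Φ)
          + MvPolynomial.X 1 * MvPolynomial.pderiv 1 (MvPolynomial.X 1 * MvPolynomial.pderiv 1 Φ)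
            * (MvPolynomial.X 0 * MvPolynomial.pderiv 0 Φ) ^ 2) = 0}.Finite)
    (hgp : ∀ p ∈ {p : Fin 2 → ℝ | 0 < p 0 ∧ 0 < p 1 ∧ MvPolynomial.eval p Φ = 0 ∧
      MvPolynomial.eval p
        (MvPolynomial.X 0 * MvPolynomial.pderiv 0 (MvPolynomial.X 0 * MvPolynomial.pderiv 0 Φ)
            * (MvPolynomial.X 1 * MvPolynomial.pderiv 1 Φ) ^ 2
          - 2 * (MvPolynomial.X 0 * MvPolynomial.pderiv 0 (MvPolynomial.X 1 * MvPolynomial.pderiv 1 Φ))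
            * (MvPolynomial.X 0 * MvPolynomial.pderiv 0 Φ) * (MvPolynomial.X 1 * MvPolynomial.pderiv 1 Φ)
          + MvPolynomial.X 1 * MvPolynomial.pderiv 1 (MvPolynomial.X 1 * MvPolynomial.pderiv 1 Φ)
            * (MvPolynomial.X 0 * MvPolynomial.pderiv 0 Φ) ^ 2) = 0},
        MvPolynomial.eval p (MvPolynomial.pderiv 1 Φ) ≠ 0)
    {α ω bstar : ℝ} {β : ℝ → ℝ} (hα : 0 < α) (hαω : α < ω) (hb : 0 < bstar)
    (hcont : ContinuousOn β (Ioo α ω)) (hsol : ∀ t ∈ Ioo α ω, MvPolynomial.eval ![t, β t] Φ = 0)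
    (hlim : Tendsto β (𝓝[>] α) (𝓝 bstar)) :
    ∃ δ > 0, ∃ β' : ℝ → ℝ, (∀ t ∈ Ioo α ω, β' t = β t) ∧ β' α = bstar ∧ ContinuousOn β' (Ioo (α - δ) ω) ∧
      (∀ t ∈ Ioo (α - δ) ω, MvPolynomial.eval ![t, β' t] Φ = 0) ∧ ∀ t ∈ Ioc (α - δ) α, 0 < β' t := by
  have hΦ : MvPolynomial.eval ![α, bstar] Φ = 0 := eval_eq_zero_of_tendsto_left Φ hαω hsol hlim
  obtain ⟨ψ, hψα, hψcd, hψsol, hU⟩ := exists_local_branch_of_hyperbolic Φ P hP hsplit hfin hgp hα hb hΦ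
  have hψca : ∀ᶠ t in 𝓝 α, ContinuousAt ψ t :=
    (hψcd.eventually (by simp)).mono fun t ht => ht.continuousAt
  have hψpos : ∀ᶠ t in 𝓝 α, 0 < ψ t := by
    have h := hψcd.continuousAt.tendsto
    rw [hψα] at h
    exact h.eventually (Ioi_mem_nhds hb)
  obtain ⟨δ₁, hδ₁, h₁⟩ : ∃ δ₁ > 0, ∀ t, dist t α < δ₁ →
      ContinuousAt ψ t ∧ MvPolynomial.eval ![t, ψ t] Φ = 0 ∧ 0 < ψ t :=
    Metric.eventually_nhds_iff.1 ((hψca.and hψsol).and hψpos |>.mono fun t h => ⟨h.1.1, h.1.2, h.2⟩)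
  -- local uniqueness: `β = ψ` just right of `α`
  have hid : Tendsto (fun u : ℝ => u) (𝓝[>] α) (𝓝 α) := tendsto_id.mono_left nhdsWithin_le_nhds
  have hU' := (hid.prodMk_nhds hlim).eventually hU
  have hev : ∀ᶠ u in 𝓝[>] α, MvPolynomial.eval ![u, β u] Φ = 0 :=
    mem_of_superset (Ioo_mem_nhdsGT hαω) fun u hu => hsol u hu
  have heq : ∀ᶠ u in 𝓝[>] α, β u = ψ u := by
    filter_upwards [hU', hev] with u hu hu0
    exact (hu.1 hu0).symm
  obtain ⟨l, hl, hlsub⟩ := mem_nhdsGT_iff_exists_Ioo_subset.1 heq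
  refine ⟨δ₁, hδ₁, fun t => if α < t then β t else ψ t, fun t ht => by simp [ht.1], by simp [hψα], ?_, ?_, ?_⟩
  · intro t ht
    refine ContinuousAt.continuousWithinAt ?_
    by_cases htα : α < t
    · have hβt : ContinuousAt β t := (hcont t ⟨htα, ht.2⟩).continuousAt (Ioo_mem_nhds htα ht.2)
      refine hβt.congr ?_
      filter_upwards [Ioi_mem_nhds htα] with u hu
      simp [show α < u from hu]
    · push Not at htα
      have hψt : ContinuousAt ψ t := (h₁ t (by rw [Real.dist_eq, abs_lt]; constructor <;> linarith [ht.1])).1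
      refine hψt.congr ?_
      have hnhds : Ioo (α - δ₁) (min l (α + δ₁)) ∈ 𝓝 t :=
        Ioo_mem_nhds ht.1 (lt_min (htα.trans_lt hl) (by linarith))
      filter_upwards [hnhds] with u hu
      by_cases huα : α < u
      · have : β u = ψ u := hlsub ⟨huα, lt_of_lt_of_le hu.2 (min_le_left _ _)⟩
        simp [huα, this]
      · simp [huα]
  · intro t ht
    by_cases htα : α < t
    · simp only [htα, if_true]; exact hsol t ⟨htα, ht.2⟩
    · simp only [htα, if_false]
      push Not at htα
      exact (h₁ t (by rw [Real.dist_eq, abs_lt]; constructor <;> linarith [ht.1])).2.1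
  · intro t ht
    have htα : ¬ α < t := not_lt.2 ht.2
    simp only [htα, if_false]
    exact (h₁ t (by rw [Real.dist_eq, abs_lt]; constructor <;> linarith [ht.1, ht.2])).2.2

/-- Closedness along a frequently-hit height, from the right. [folklore] -/
theorem eval_eq_zero_of_frequently_right (Φ : MvPolynomial (Fin 2) ℝ) {α b : ℝ}
    (h : ∃ᶠ s in 𝓝[>] α, MvPolynomial.eval ![s, b] Φ = 0) : MvPolynomial.eval ![α, b] Φ = 0 := by
  have hc : Continuous (fun s : ℝ => MvPolynomial.eval ![s, b] Φ) :=
    Continuous.congr ((continuous_eval₂ Φ).comp₂ continuous_id continuous_const) fun _ => rfl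
  have hclosed : IsClosed {s : ℝ | MvPolynomial.eval ![s, b] Φ = 0} := isClosed_eq hc continuous_const
  have hid : Tendsto (fun u : ℝ => u) (𝓝[>] α) (𝓝 α) := tendsto_id.mono_left nhdsWithin_le_nhds
  exact hclosed.mem_of_frequently_of_tendsto h hid

/-- **No oscillation at the LEFT end** (finite osculation set, `α > 0`). [folklore] -/
theorem not_oscillating_left_end (Φ : MvPolynomial (Fin 2) ℝ) (P : ℝ → ℝ[X])
    (hP : ∀ t b, (P t).eval b = MvPolynomial.eval ![t, b] Φ)
    (hfin : {p : Fin 2 → ℝ | 0 < p 0 ∧ 0 < p 1 ∧ MvPolynomial.eval p Φ = 0 ∧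
      MvPolynomial.eval p
        (MvPolynomial.X 0 * MvPolynomial.pderiv 0 (MvPolynomial.X 0 * MvPolynomial.pderiv 0 Φ)
            * (MvPolynomial.X 1 * MvPolynomial.pderiv 1 Φ) ^ 2
          - 2 * (MvPolynomial.X 0 * MvPolynomial.pderiv 0 (MvPolynomial.X 1 * MvPolynomial.pderiv 1 Φ))
            * (MvPolynomial.X 0 * MvPolynomial.pderiv 0 Φ) * (MvPolynomial.X 1 * MvPolynomial.pderiv 1 Φ)
          + MvPolynomial.X 1 * MvPolynomial.pderiv 1 (MvPolynomial.X 1 * MvPolynomial.pderiv 1 Φ)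
            * (MvPolynomial.X 0 * MvPolynomial.pderiv 0 Φ) ^ 2) = 0}.Finite)
    {α ω b₁ b₂ : ℝ} {β : ℝ → ℝ} (hα : 0 < α) (hαω : α < ω) (hb : b₁ < b₂)
    (hcont : ContinuousOn β (Ioo α ω)) (hsol : ∀ t ∈ Ioo α ω, MvPolynomial.eval ![t, β t] Φ = 0)
    (h₁ : ∃ᶠ t in 𝓝[>] α, β t ≤ b₁) (h₂ : ∃ᶠ t in 𝓝[>] α, b₂ ≤ β t) : False := by
  have hhit : ∀ b ∈ Ioo b₁ b₂, ∃ᶠ s in 𝓝[>] α, MvPolynomial.eval ![s, b] Φ = 0 := by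
    intro b hbI
    rw [Filter.frequently_iff]
    intro U hU
    obtain ⟨l, hl, hlU⟩ := mem_nhdsGT_iff_exists_Ioo_subset.1 hU
    have hl' : α < min l ω := lt_min hl hαω
    have hmem : Ioo α (min l ω) ∈ 𝓝[>] α := Ioo_mem_nhdsGT hl'
    obtain ⟨t', ht'β, ht'I⟩ := (h₁.and_eventually hmem).exists
    obtain ⟨t'', ht''β, ht''I⟩ := (h₂.and_eventually hmem).exists
    have hsubαω : ∀ u, min t' t'' ≤ u → u ≤ max t' t'' → u ∈ Ioo α ω := fun u hu1 hu2 =>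
      ⟨lt_of_lt_of_le (lt_min ht'I.1 ht''I.1) hu1,
        lt_of_le_of_lt hu2 (max_lt (ht'I.2.trans_le (min_le_right _ _)) (ht''I.2.trans_le (min_le_right _ _)))⟩
    have hsubU : ∀ u, min t' t'' ≤ u → u ≤ max t' t'' → u ∈ U := fun u hu1 hu2 =>
      hlU ⟨lt_of_lt_of_le (lt_min ht'I.1 ht''I.1) hu1,
        lt_of_le_of_lt hu2 (max_lt (ht'I.2.trans_le (min_le_left _ _)) (ht''I.2.trans_le (min_le_left _ _)))⟩
    rcases le_total t' t'' with hle | hle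
    · have hc : ContinuousOn β (Icc t' t'') := hcont.mono fun u hu =>
        hsubαω u (by rw [min_eq_left hle]; exact hu.1) (by rw [max_eq_right hle]; exact hu.2)
      obtain ⟨s, hs, hsb⟩ := intermediate_value_Icc hle hc ⟨ht'β.trans hbI.1.le, hbI.2.le.trans ht''β⟩
      refine ⟨s, hsubU s (by rw [min_eq_left hle]; exact hs.1) (by rw [max_eq_right hle]; exact hs.2), ?_⟩
      rw [← hsb]
      exact hsol s (hsubαω s (by rw [min_eq_left hle]; exact hs.1) (by rw [max_eq_right hle]; exact hs.2))
    · have hc : ContinuousOn β (Icc t'' t') := hcont.mono fun u hu =>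
        hsubαω u (by rw [min_eq_right hle]; exact hu.1) (by rw [max_eq_left hle]; exact hu.2)
      obtain ⟨s, hs, hsb⟩ := intermediate_value_Icc' hle hc ⟨ht'β.trans hbI.1.le, hbI.2.le.trans ht''β⟩
      refine ⟨s, hsubU s (by rw [min_eq_right hle]; exact hs.1) (by rw [max_eq_left hle]; exact hs.2), ?_⟩
      rw [← hsb]
      exact hsol s (hsubαω s (by rw [min_eq_right hle]; exact hs.1) (by rw [max_eq_left hle]; exact hs.2))
  have hroots : ∀ b ∈ Ioo b₁ b₂, (P α).IsRoot b := fun b hbI => by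
    rw [IsRoot, hP]; exact eval_eq_zero_of_frequently_right Φ (hhit b hbI)
  have hP0 : P α = 0 :=
    Polynomial.eq_zero_of_infinite_isRoot _ ((Set.Ioo_infinite hb).mono fun b hbI => hroots b hbI)
  exact not_finite_of_vanishing_fibre Φ P hP hα hP0 hfin

end OsculationPeel

end Summit.ValiantsHypothesis.ValiantsHypothesis.Theorems.LacunarySymmetroidMatrixDescartes

end
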